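import Summits.Ventures.YMGap.Conjectures.StrongCouplingChiralLROMesonWeightInfraredBound
import Summits.Ventures.YMGap.Conjectures.StrongCouplingChiralLROMesonWeightAxisPermutation
import HarnessLib
import HarnessLib.Audit.Tags

/-!
# The `N = 1` conjunct of `SalmhoferSeilerSmallBeta`: chiral long-range order of compact lattice QED
# with one staggered fermion at small `β > 0`, uniformly in the volume

Cell `pub-ymgap`, seat qcd-lit g21 (literature-prover), `bears_on: Q1` (typed node
`Summit.Ventures.YMGap.Conjectures.SalmhoferSeilerSmallBeta`, file `…/Conjectures/StrongCouplingChiralLRO.lean`).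
Everything is a theorem (0 facts, 0 sorry).

**`infraredBound_one'`** — row S3 of the census of `…StrongCouplingChiralLROReduction` FOR `N = 1` AT EVERY
`β ≥ 0`: on the even torus `(ℤ/Lℤ)^ν` (`ν ≥ 1`) the conjecture's kernel `T_β = ssTwoPoint 1 ν L β 0` obeys the
mode-wise infrared bound (IR)_{β,4}, `2(ν - C(χ))·Re T̂_β(χ) ≤ 4`, `-2(ν + C(χ))·Re T̂_β(χ) ≤ 4` for every
character `χ`, uniformly in `L` and `β` — Salmhofer–Seiler's Thm. 3.21 / (3.112)–(3.113) beyond `β = 0`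
(the open step named by `salmhoferSeilerSmallBeta_of_infraredBound`), for one flavour.

**`chiralLRO_one`** — THE `N = 1` CONJUNCT OF THE TYPED CONJECTURE `SalmhoferSeilerSmallBeta`: for every
`ν ≥ 4` there are `β₀ > 0`, `c > 0`, `L₀` such that `ssChiralOrder 1 ν L β ≥ c` for all `0 ≤ β < β₀` and all
even `L ≥ L₀` (and `salmhoferSeilerSmallBeta_conjunct_one`: the conjecture's `N = 1` instance verbatim);
hence **`salmhoferSeilerSmallBeta_iff_two_le`**: the typed conjecture is equivalent to its conjuncts `N = 2, 3, 4`.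

Proof (this seat's series, all in the tree): Gaussian-corrected reflection positivity of the one-flavour
theory at every `β` (`StaggeredGaugeGaussianCorrectedReflectionPositivity` = Salmhofer–Seiler's Remark 4.5
at `β > 0`) ⟶ the Fröhlich–Israel–Lieb–Simon chain for a general reflection-positive weight
(`ComplexSpinRPWeightGaussianDomination`, `…InfraredBound`) ⟶ the `β`-dressed meson weight and its
background weight (`…MesonWeight`, `…Background`, `…TimePlane`) ⟶ all planes by lattice symmetry
(`…AllPlanes`), the symmetries being PROVED (`…Translation`, `…AxisPermutationGauge`, `…AxisPermutation`)
⟶ (IR)_{β,4} (`…MesonWeightInfraredBound`) ⟶ with the tree's Schwinger–Dyson half at small `β`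
(`schwingerDysonBound_smallBeta`), `K(1) = 1` and `S(ν) < 7/20`, the printed conclusion (4.41)–(4.42).

Honest framing: `N = 1` ONLY (compact `U(1)` with one staggered fermion; for `N ≥ 2` the crossing Gaussian
of Remark 4.5 is not termwise positive and this route does not apply); finite even tori, small `β ≥ 0`;
nothing about the continuum limit, `SU(3)`, several flavours, or the summit's `QCD` conjunct, which this
does not touch.  The conjuncts `N = 2, 3, 4` of `SalmhoferSeilerSmallBeta` remain open.

## References
* [SalmhoferSeiler1991] M. Salmhofer, E. Seiler, *Proof of chiral symmetry breaking in strongly coupled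
  lattice gauge theory*, Commun. Math. Phys. 139 (1991) 395–432, Thm. 3.21, Thm. 4.8, Cor. 4.9,
  Remarks 4.5–4.6.
* [FrohlichIsraelLiebSimon1978] J. Fröhlich, R. Israel, E. H. Lieb, B. Simon, Commun. Math. Phys. 62
  (1978) 1–34.
-/

noncomputable section

open scoped BigOperators
open Literature.MathematicalPhysics.StatisticalMechanics
open Literature.MathematicalPhysics.StatisticalMechanics.ComplexSpin
open Literature.Probability.LatticeModels (TorusSite)

namespace Summit.Ventures.YMGap.Conjectures

namespace MesonWeight

variable {ν L : ℕ} [NeZero L]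

/-- **(IR)_{β,4} FOR COMPACT LATTICE QED WITH ONE STAGGERED FERMION AT EVERY `β ≥ 0`, UNIFORMLY IN THE
VOLUME** (no hypotheses beyond `L` even, `ν ≥ 1`). [cite: SalmhoferSeiler1991, Thm. 3.21 with (3.112)–(3.113) and Remark 4.5] -/
theorem infraredBound_one' [NeZero ν] (hL : Even L) {β : ℝ} (hβ : 0 ≤ β) (χ : AddChar (TorusSite ν L) ℂ) :
    2 * ((ν : ℝ) - cosSum χ) * (kernelSymbol (fun x y => ssTwoPoint 1 ν L β 0 x y) χ).re ≤ 4 ∧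
      2 * ((ν : ℝ) + cosSum χ) * (-(kernelSymbol (fun x y => ssTwoPoint 1 ν L β 0 x y) χ).re) ≤ 4 := by
  letI : LinearOrder (TorusSite ν L) :=
    LinearOrder.lift' (Fintype.equivFin (TorusSite ν L)) (Fintype.equivFin (TorusSite ν L)).injective
  exact infraredBound_one hL hβ (fun c m => mesonMoment_mapDomain_addRight hL β c m)
    (fun i m => mesonMoment_mapDomain_axisSwap hL β i m) χ

/-- **CHIRAL LONG-RANGE ORDER FOR COMPACT LATTICE QED WITH ONE STAGGERED FERMION AT SMALL `β > 0`,
UNIFORMLY IN THE VOLUME** — the `N = 1` conjunct of the typed conjecture `SalmhoferSeilerSmallBeta`, now a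
theorem. [cite: SalmhoferSeiler1991, Thm. 4.8 and Cor. 4.9 with (4.41)–(4.42), Remark 4.5] -/
theorem chiralLRO_one (hν : 4 ≤ ν) :
    ∃ β₀ : ℝ, 0 < β₀ ∧ ∃ c : ℝ, 0 < c ∧ ∃ L₀ : ℕ, ∀ β : ℝ, 0 ≤ β → β < β₀ →
      ∀ (L : ℕ) [NeZero L], Even L → L₀ ≤ L → c ≤ ssChiralOrder 1 ν L β := by
  haveI : NeZero ν := ⟨by omega⟩
  exact chiralLRO_one_of_latticeSymmetric hν fun L _ _ β _ hL =>
    ⟨fun c m => mesonMoment_mapDomain_addRight hL β c m, fun i m => mesonMoment_mapDomain_axisSwap hL β i m⟩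

/-- **The `N = 1` instance of `SalmhoferSeilerSmallBeta`, verbatim** (the conjecture's body with `N = 1`). [cite: SalmhoferSeiler1991, Cor. 4.9] -/
theorem salmhoferSeilerSmallBeta_conjunct_one (ν : ℕ) (_h1 : 1 ≤ 1) (_h4 : 1 ≤ 4) (hν : 4 ≤ ν) :
    ∃ β₀ : ℝ, 0 < β₀ ∧ ∃ c : ℝ, 0 < c ∧ ∃ L₀ : ℕ, ∀ β : ℝ, 0 ≤ β → β < β₀ →
      ∀ (L : ℕ) [NeZero L], Even L → L₀ ≤ L → c ≤ ssChiralOrder 1 ν L β :=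
  chiralLRO_one hν

/-! ### `SalmhoferSeilerSmallBeta` reduced to its conjuncts `N = 2, 3, 4` -/

/-- **THE TYPED CONJECTURE `SalmhoferSeilerSmallBeta` (Y3) NOW FOLLOWS FROM ITS CONJUNCTS `N = 2, 3, 4` ALONE**
(the conjunct `N = 1` being `chiralLRO_one`). [cite: SalmhoferSeiler1991, §5 p. 424 with Cor. 4.9] -/
theorem salmhoferSeilerSmallBeta_of_two_le
    (h : ∀ N ν : ℕ, 2 ≤ N → N ≤ 4 → 4 ≤ ν →
      ∃ β₀ : ℝ, 0 < β₀ ∧ ∃ c : ℝ, 0 < c ∧ ∃ L₀ : ℕ, ∀ β : ℝ, 0 ≤ β → β < β₀ →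
        ∀ (L : ℕ) [NeZero L], Even L → L₀ ≤ L → c ≤ ssChiralOrder N ν L β) :
    SalmhoferSeilerSmallBeta := by
  intro N ν hN1 hN4 hν
  rcases Nat.lt_or_ge N 2 with hN | hN
  · obtain rfl : N = 1 := by omega
    exact chiralLRO_one hν
  · exact h N ν hN hN4 hν

/-- `SalmhoferSeilerSmallBeta` is EQUIVALENT to its conjuncts `N = 2, 3, 4`. [cite: SalmhoferSeiler1991, §5 p. 424 with Cor. 4.9] -/
theorem salmhoferSeilerSmallBeta_iff_two_le :
    SalmhoferSeilerSmallBeta ↔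
      ∀ N ν : ℕ, 2 ≤ N → N ≤ 4 → 4 ≤ ν →
        ∃ β₀ : ℝ, 0 < β₀ ∧ ∃ c : ℝ, 0 < c ∧ ∃ L₀ : ℕ, ∀ β : ℝ, 0 ≤ β → β < β₀ →
          ∀ (L : ℕ) [NeZero L], Even L → L₀ ≤ L → c ≤ ssChiralOrder N ν L β :=
  ⟨fun h N ν hN hN4 hν => h N ν (by omega) hN4 hν, salmhoferSeilerSmallBeta_of_two_le⟩

end MesonWeight

end Summit.Ventures.YMGap.Conjectures

end
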